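import Mathlib
import Summits.MatrixMultiplication.MatrixMultiplication.Theorems.SoloBlindFamTables
import Summits.MatrixMultiplication.MatrixMultiplication.Theorems.SoloBlindTypeModelTwo

/-!
# Solo-blind (K₃) programme — the finite all-rank checker for Conjectures K♭ / E♭ (pattern DFS)

Executable content of the reduction K3.50: for a presence family `F` (bitmasks over `m` letters, first
member `C₀`) this file computes

* `W⊥`: the letter vectors `w ∈ (ZMod 3)^m` (codes `< 3^m`) with `w · 1_M = w · 1_{C₀}` for all `M ∈ F`;
* the NEEDS: zero-sum constraints `T ≠ 0` with `w · 1_T = 0` on `W⊥`, absent sets `C ∉ F` with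
  `w · 1_C = w · 1_{C₀}` on `W⊥`, and (mode E) the `H`-constraints `T` with `w · (1_T + 1_{C₀}) = 0` on `W⊥`
  — exactly the constraints that cannot be discharged by an invisible block index or an ambient index;
* the visible TYPES `t ∈ (ZMod 3)^{m+1}` (all residues over `F` in `{0,1}`, some residue `1`), their
  PATTERNS (the set of members with residue `1`, a bitmask over member indices) and, per need, the
  bitmask of patterns containing a type that kills it;
* a greedy lower bound `d` for the dimension of the difference space `span {1_M - 1_{C₀}}`, certified by
  triangular witnesses `w` (`soloBlindFlatGreedy`);
* a DFS over sets `Π` of patterns (`soloBlindFlatKids`), pruned as soon as the scaled pattern mass is below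
  the right-hand side, checking at every VALID `Π` (all needs killed) the vertex conditions
  (V0) `K(Π) - 2^{-(m-d+|Π|)} ≤ R` and (V1) `Rest_π(Π) ≤ R` for `π ∈ Π`, with `R = 1 - 2^{-d}`
  (mode K) resp. `R = 1/2 - 2^{-(d+1)}` (mode E), in integers scaled by `2^S` with outward rounding.

`soloBlindFlatFamCheck m S F modeE` is the per-family verdict; its soundness (pattern-model level and
configuration level) is proved in the sequel files.  No `native_decide` here.
-/

namespace Summit.MatrixMultiplication.MatrixMultiplication.Theorems

open Finset

/-! ## Memo tables of residues and type sums -/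

/-- Memo tables for `m` letters: residues and type sums of every type code `t < 3^(m+1)` at every
mask `M < 2^m`, row-major index `t * 2^m + M`. -/
structure SoloBlindFlatTabs where
  /-- `r1[t * 2^m + M] = (Resid m t M = 1)` -/
  r1 : Array Bool
  /-- `r2[t * 2^m + M] = (Resid m t M = 2)` -/
  r2 : Array Bool
  /-- `ts[t * 2^m + M] = (TSum m t M false).val` -/
  ts : Array ℕ
  /-- `tt[t * 2^m + M] = (TSum m t M true).val` -/
  tt : Array ℕ

/-- Build the memo tables. -/
def soloBlindMkFlatTabs (m : ℕ) : SoloBlindFlatTabs where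
  r1 := Array.ofFn (n := 3 ^ (m + 1) * 2 ^ m) fun i => decide (soloBlindResid m (i / 2 ^ m) (i % 2 ^ m) = 1)
  r2 := Array.ofFn (n := 3 ^ (m + 1) * 2 ^ m) fun i => decide (soloBlindResid m (i / 2 ^ m) (i % 2 ^ m) = 2)
  ts := Array.ofFn (n := 3 ^ (m + 1) * 2 ^ m) fun i => (soloBlindTSum m (i / 2 ^ m) (i % 2 ^ m) false).val
  tt := Array.ofFn (n := 3 ^ (m + 1) * 2 ^ m) fun i => (soloBlindTSum m (i / 2 ^ m) (i % 2 ^ m) true).val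

/-! ## Letter vectors, needs, types, patterns (table-based) -/

/-- `w · (1_M - 1_{C₀}) = 0` for the letter-vector code `w` (read as a type code with `τ`-digit `0`). -/
def soloBlindWDiffZero (T : SoloBlindFlatTabs) (m w M C₀ : ℕ) : Bool :=
  soloBlindNGet T.ts (w * 2 ^ m + M) == soloBlindNGet T.ts (w * 2 ^ m + C₀)

/-- `W⊥`: letter vectors orthogonal to every difference `1_M - 1_{C₀}`, `M ∈ F`. -/
def soloBlindWPerp (T : SoloBlindFlatTabs) (m : ℕ) (F : List ℕ) (C₀ : ℕ) : List ℕ :=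
  (List.range (3 ^ m)).filter fun w => F.all fun M => soloBlindWDiffZero T m w M C₀

/-- Zero-sum needs: `U ≠ 0` with `w · 1_U = 0` for all `w ∈ W⊥`. -/
def soloBlindNeedZ (T : SoloBlindFlatTabs) (m : ℕ) (Wp : List ℕ) : List ℕ :=
  (List.range (2 ^ m)).filter fun U =>
    (U != 0) && Wp.all fun w => soloBlindNGet T.ts (w * 2 ^ m + U) == 0

/-- Exactness needs: absent `C` with `w · (1_C - 1_{C₀}) = 0` for all `w ∈ W⊥`. -/
def soloBlindNeedX (T : SoloBlindFlatTabs) (m : ℕ) (F : List ℕ) (C₀ : ℕ) (Wp : List ℕ) : List ℕ :=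
  (List.range (2 ^ m)).filter fun C => !(F.elem C) && Wp.all fun w => soloBlindWDiffZero T m w C C₀

/-- `H`-needs (mode E): `U` with `w · (1_U + 1_{C₀}) = 0` for all `w ∈ W⊥`. -/
def soloBlindNeedH (T : SoloBlindFlatTabs) (m : ℕ) (C₀ : ℕ) (Wp : List ℕ) : List ℕ :=
  (List.range (2 ^ m)).filter fun U => Wp.all fun w =>
    (soloBlindNGet T.ts (w * 2 ^ m + U) + soloBlindNGet T.ts (w * 2 ^ m + C₀)) % 3 == 0

/-- A type code is VISIBLE for `F`: no residue `2` over `F` and some residue `1`. -/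
def soloBlindVisible (T : SoloBlindFlatTabs) (m : ℕ) (F : List ℕ) (t : ℕ) : Bool :=
  (F.all fun M => !soloBlindAGet T.r2 (t * 2 ^ m + M)) && F.any fun M => soloBlindAGet T.r1 (t * 2 ^ m + M)

/-- The pattern of a type: bit `k` is set iff the residue at the `k`-th member is `1`. -/
def soloBlindPatOf (T : SoloBlindFlatTabs) (m : ℕ) (F : List ℕ) (t : ℕ) : ℕ :=
  soloBlindEnc ((Finset.range F.length).filter fun k => soloBlindAGet T.r1 (t * 2 ^ m + F.getD k 0))

/-- The visible type codes. -/
def soloBlindVisTypes (T : SoloBlindFlatTabs) (m : ℕ) (F : List ℕ) : List ℕ :=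
  (List.range (3 ^ (m + 1))).filter (soloBlindVisible T m F)

/-- The distinct patterns of visible types. -/
def soloBlindPats (T : SoloBlindFlatTabs) (m : ℕ) (F : List ℕ) : List ℕ :=
  ((soloBlindVisTypes T m F).map (soloBlindPatOf T m F)).dedup

/-- Need kinds: zero-sum (`U`), exactness (`C`), `H` (`U`). -/
inductive SoloBlindNeed where
  /-- zero-sum constraint on the letter set `U` -/
  | z : ℕ → SoloBlindNeed
  /-- exactness constraint on the absent letter set `C` -/
  | x : ℕ → SoloBlindNeed
  /-- `H`-goodness constraint on the letter set `U` -/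
  | hh : ℕ → SoloBlindNeed
  deriving DecidableEq

/-- A visible block type `t` kills a need. -/
def soloBlindKills (T : SoloBlindFlatTabs) (m : ℕ) (t : ℕ) : SoloBlindNeed → Bool
  | .z U => soloBlindNGet T.ts (t * 2 ^ m + U) == 1
  | .x C => soloBlindAGet T.r2 (t * 2 ^ m + C)
  | .hh U => soloBlindNGet T.tt (t * 2 ^ m + U) == 1

/-- All needs of the family in the given mode. -/
def soloBlindNeeds (T : SoloBlindFlatTabs) (m : ℕ) (F : List ℕ) (C₀ : ℕ) (modeE : Bool) :
    List SoloBlindNeed :=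
  let Wp := soloBlindWPerp T m F C₀
  (soloBlindNeedZ T m Wp).map SoloBlindNeed.z ++ (soloBlindNeedX T m F C₀ Wp).map SoloBlindNeed.x ++
    (if modeE then (soloBlindNeedH T m C₀ Wp).map SoloBlindNeed.hh else [])

/-- The visible types with a given pattern. -/
def soloBlindBucket (T : SoloBlindFlatTabs) (m : ℕ) (F : List ℕ) (p : ℕ) : List ℕ :=
  (soloBlindVisTypes T m F).filter fun t => soloBlindPatOf T m F t == p

/-- Killer mask of a need: bit `j` set iff some visible type of the `j`-th pattern kills it. -/
def soloBlindKillerMask (T : SoloBlindFlatTabs) (m : ℕ) (buckets : List (List ℕ)) (N : SoloBlindNeed) : ℕ :=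
  soloBlindEnc ((Finset.range buckets.length).filter fun j =>
    (buckets.getD j []).any fun t => soloBlindKills T m t N)

/-- Validity of a pattern-index mask: every need has a killer among the chosen patterns. -/
def soloBlindValidMask (kms : List ℕ) (pm : ℕ) : Bool :=
  kms.all fun km => km &&& pm != 0

/-! ## The greedy dimension certificate -/

/-- Some letter vector separates `M` from the chosen members: `w · v_M ≠ 0`, `w · v_{M'} = 0`. -/
def soloBlindSeparated (T : SoloBlindFlatTabs) (m : ℕ) (C₀ : ℕ) (ch : List ℕ) (M : ℕ) : Bool :=
  (List.range (3 ^ m)).any fun w =>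
    !soloBlindWDiffZero T m w M C₀ && ch.all fun M' => soloBlindWDiffZero T m w M' C₀

/-- Greedy triangular selection of members with independent difference vectors. -/
def soloBlindFlatGreedy (T : SoloBlindFlatTabs) (m : ℕ) (C₀ : ℕ) : List ℕ → List ℕ → List ℕ
  | [], ch => ch
  | M :: rest, ch =>
    if soloBlindSeparated T m C₀ ch M then soloBlindFlatGreedy T m C₀ rest (ch ++ [M])
    else soloBlindFlatGreedy T m C₀ rest ch

/-- The certified lower bound `d` for `dim span {1_M - 1_{C₀} : M ∈ F}`. -/
def soloBlindFlatD (T : SoloBlindFlatTabs) (m : ℕ) (F : List ℕ) (C₀ : ℕ) : ℕ :=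
  (soloBlindFlatGreedy T m C₀ F []).length

/-! ## Scaled arithmetic and the DFS -/

/-- Upward-rounded `2^(S-e)` (at least `1`), read off the power table `P[e] = 2^(S-e)`. -/
def soloBlindUp (P : Array ℕ) (S e : ℕ) : ℕ := if e ≤ S then soloBlindNGet P e else 1

/-- Downward-rounded `2^(S-e)` (`0` beyond the scale). -/
def soloBlindDn (S e : ℕ) : ℕ := if e ≤ S then 2 ^ (S - e) else 0

/-- The power table `P[e] = 2^(S-e)`, `e ≤ S`. -/
def soloBlindPowTab (S : ℕ) : Array ℕ := Array.ofFn (n := S + 1) fun e => 2 ^ (S - e)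

/-- Scaled pattern mass `∑_k Up(sz_k + cnt_k)` over the member indices. -/
def soloBlindKsc (P : Array ℕ) (S : ℕ) (szs cnt : List ℕ) : ℕ :=
  ∑ k ∈ Finset.range szs.length, soloBlindUp P S (szs.getD k 0 + cnt.getD k 0)

/-- Scaled rest mass of pattern `p`: the members NOT seen by `p`. -/
def soloBlindRestSc (P : Array ℕ) (S : ℕ) (szs cnt : List ℕ) (p : ℕ) : ℕ :=
  ∑ k ∈ (Finset.range szs.length).filter (fun k => !p.testBit k),
    soloBlindUp P S (szs.getD k 0 + cnt.getD k 0)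

/-- Adding a pattern raises the exponent of every member it sees. -/
def soloBlindBump (cnt : List ℕ) (p : ℕ) : List ℕ :=
  (List.range cnt.length).map fun k => cnt.getD k 0 + if p.testBit k then 1 else 0

/-- The constants of a family check: scale, sizes, killer masks, `base = R·2^S + 2^(S-d')`-data. -/
structure SoloBlindFlatInst where
  /-- scale exponent `S` -/
  S : ℕ
  /-- power table `2^(S-e)` -/
  P : Array ℕ
  /-- member sizes `|M_k|` -/
  szs : List ℕ
  /-- killer masks of the needs -/
  kms : List ℕ
  /-- `2^S` (mode K) or `2^(S-1)` (mode E) -/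
  one : ℕ
  /-- `2^(S-d)` (mode K) or `2^(S-d-1)` (mode E) -/
  dterm : ℕ
  /-- the exponent offset `m - d` of the `E`-term -/
  eoff : ℕ

/-- The vertex conditions at the pattern set with index mask `pm`, size `u`, exponents `cnt`,
chosen pattern list `chosen`. -/
def soloBlindHere (I : SoloBlindFlatInst) (pm u : ℕ) (cnt : List ℕ) (chosen : List ℕ) : Bool :=
  !soloBlindValidMask I.kms pm ||
    (decide (soloBlindKsc I.P I.S I.szs cnt + I.dterm ≤ I.one + soloBlindDn I.S (I.eoff + u)) &&
      chosen.all fun p => decide (soloBlindRestSc I.P I.S I.szs cnt p + I.dterm ≤ I.one))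

/-- The DFS below a node: try to add each remaining pattern (index `j`, mask `p`) in turn. -/
def soloBlindFlatKids (I : SoloBlindFlatInst) : List (ℕ × ℕ) → ℕ → ℕ → List ℕ → List ℕ → Bool
  | [], _, _, _, _ => true
  | (j, p) :: rest, pm, u, cnt, chosen =>
    (let cnt' := soloBlindBump cnt p
     soloBlindHere I (pm ||| 2 ^ j) (u + 1) cnt' (p :: chosen) &&
       (decide (soloBlindKsc I.P I.S I.szs cnt' + I.dterm ≤ I.one) ||
         soloBlindFlatKids I rest (pm ||| 2 ^ j) (u + 1) cnt' (p :: chosen))) &&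
      soloBlindFlatKids I rest pm u cnt chosen

/-- The instance of a family. -/
def soloBlindFlatInstOf (T : SoloBlindFlatTabs) (m S : ℕ) (F : List ℕ) (modeE : Bool) :
    SoloBlindFlatInst :=
  let C₀ := F.headD 0
  let ps := soloBlindPats T m F
  let d := soloBlindFlatD T m F C₀
  { S := S
    P := soloBlindPowTab S
    szs := F.map fun M => (soloBlindDecSet m M).card
    kms := (soloBlindNeeds T m F C₀ modeE).map
      (soloBlindKillerMask T m (ps.map (soloBlindBucket T m F)))
    one := if modeE then 2 ^ (S - 1) else 2 ^ S
    dterm := if modeE then 2 ^ (S - d - 1) else 2 ^ (S - d)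
    eoff := m - d }

/-- THE PER-FAMILY CHECK (all letters used, at least two members assumed by the caller). -/
def soloBlindFlatFamCheck (T : SoloBlindFlatTabs) (m S : ℕ) (F : List ℕ) (modeE : Bool) : Bool :=
  let I := soloBlindFlatInstOf T m S F modeE
  let ps := soloBlindPats T m F
  let cnt0 := F.map fun _ => 0
  decide (soloBlindKsc I.P S I.szs cnt0 + I.dterm ≤ I.one) ||
    soloBlindFlatKids I ((List.range ps.length).map fun j => (j, ps.getD j 0)) 0 0 cnt0 []

/-- All letters are used and the family has at least two members. -/
def soloBlindFlatAdmissible (m : ℕ) (F : List ℕ) : Bool :=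
  decide (2 ≤ F.length) && (List.range m).all fun a => F.any fun M => M.testBit a

end Summit.MatrixMultiplication.MatrixMultiplication.Theorems
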